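import Summits.BirchSwinnertonDyer.BirchSwinnertonDyer.Theorems.KatoDescentPotSupersingularWildUpperUnitTwistRecordsSharpP23
import Summits.BirchSwinnertonDyer.BirchSwinnertonDyer.Theorems.KatoDescentPotSupersingularWildUpperUnitTwistRecordsSharpP24
import Summits.BirchSwinnertonDyer.BirchSwinnertonDyer.Theorems.KatoDescentPotSupersingularWildUpperUnitTwistRecordsSharpP25
import Summits.BirchSwinnertonDyer.BirchSwinnertonDyer.Theorems.KatoDescentPotSupersingularWildUpperUnitTwistRecordsSharpP26
import Summits.BirchSwinnertonDyer.Rank1Residual.Additive.IntModelTamagawaCertificateLocal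
import HarnessLib

/-!
# Route `KatoDescentPotSupersingular` (rung K9, sub-rung B5 = O6 wild `p = 3`, cell `bsd-potss`): TAMAGAWA KERNEL UPGRADE of the ♯ₚ
# unit-twist records — `∏ c_ℓ(E)` and `c₃(E) = 3` IN THE KERNEL by the rank-2 observatory's Tate certificates, so that the displayed
# single-carrier clause `hcarrier` of each ♯ₚ record is DISCHARGED (part 10: 487350q1@3, 496800cr1@3, 388800ha1@3, 388800ij1@3, 81675bq1@3)
# (seat `bsd-potss-k9-c4` g17; `--supports stmt-BirchSwinnertonDyer-19197 --as helper`)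

HONEST FRAMING. THEOREMS ONLY (no definition, no named fact, no `sorry`); PER PAIR; nothing booked; items 19189 / 19197 / 21422 stay
OPEN class-wide; BSD is not proved for any class.  Each ♯ₚ record `WildUpperUnitTwistRecords.missingUpperBoundAt_g<label>_3` (files
`…WildUpperUnitTwistRecordsSharpPNN`, this seat, road p610552) displays, among its per-row hypotheses, the single-carrier clause
`hcarrier : ord₃ ∏ c_ℓ(E) ≤ ord₃ c₃(E)` (read off Cremona's table / k8t-c4 g6's PARI census).  The rank-2 observatory's KERNEL
TAMAGAWA CERTIFICATES (`Theorems/Rank2ObservatoryTamagawa{Local,Cert,ExactCert,KernelCert}` — Tate's algorithm as `decide`-able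
certificates `TamLocal` / `TamX` / `TamZ` with ONE soundness theorem per stage, NO named fact) and the b2b-bsdres n1011 bridge to a
globally minimal `W / ℚ` with a literal integral model (`Additive/IntModelTamagawaCertificate{,Local}`:
`tamagawaProduct_eq_rowValueZ_of_intModel`, `localTamagawaNumber_padic_eq_of_intModel_of_tamX`) make both sides of that clause KERNEL
NUMERALS: per row below, `rowCheckZ_g<label>` (the row certificate checks, `decide +kernel`), `tamagawaProduct_g<label> : ∏ c_ℓ(W) = v`,
`localTamagawaNumber_three_g<label> : c(W / ℚ_[3]) = 3` (Kodaira IV* at `3`, Step-8 quadratic with a residue root — stage-2 exact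
certificate `TamX` kind 3), `carrier_g<label>` (the clause itself, `v = 3·m`, `3 ∤ m`), and the corollary
`missingUpperBoundAt_g<label>_3_tam` = the record with `hcarrier` REMOVED (every other displayed binder unchanged: named facts
`hGZ hKo hGZK hmod`, the schema `hJp`, Cremona's `N`, `r_an = 0`, «tower not onto», the lattice-optimal datum with `3 ∤ c(D)`, the
field, the twist numerics).  Certificates emitted by n1011-p03's `tools/tamcert.py` over the observatory's `kernel-tam3/engine1`
(`tam.py` / `tamx.py` / `tamz.py`, unmodified) and RE-CHECKED here by the kernel; the certified products agree with Cremona's `∏ c_ℓ`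
and k8t-c4 g6's PARI `elllocalred` table on every row (generator asserts).

References: [Tate1975] §7; [Silverman1994] IV.9.4 Steps 1–10; [SilvermanAEC2009] VII.1 Rem. 1.1, VII.6; [CremonaAlgorithms1997] §3.2,
Table 1; [Jetchev2008] Cor. 1.5; [Miller2011LMS] Def. 1.1.
-/

set_option autoImplicit false
set_option linter.dupNamespace false
noncomputable section
open scoped Classical NumberField
open WeierstrassCurve NumberField Field
  Literature.NumberTheory.EllipticCurves
  Literature.NumberTheory.EllipticCurves.ModularForms Literature.NumberTheory.EllipticCurves.Rank1Residual
  Literature.NumberTheory.EllipticCurves.Rank1Residual.Typed Literature.NumberTheory.Automorphic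
  Summit.BirchSwinnertonDyer.BirchSwinnertonDyer.Rank2Observatory.Tam
  Summit.BirchSwinnertonDyer.Rank1Residual.Additive.IntModelTam
  Summit.BirchSwinnertonDyer.BirchSwinnertonDyer.Rank1Residual.IntModel
  Summit.BirchSwinnertonDyer.Rank1Residual Summit.BirchSwinnertonDyer.Rank1Residual.Additive
  Summit.BirchSwinnertonDyer.BirchSwinnertonDyer.Theorems

namespace Summit.BirchSwinnertonDyer.BirchSwinnertonDyer.Theorems.WildUpperUnitTwistRecords

/-! ### `487350q1` (`N = 487350 = 2·3^3·5^2·19^2`, record file `…SharpP23`): Tate certificates — `2`: In, `c = 1`; `3`: IV*, `c = 3`; `5`: I0*, `c = 1`; `19`: III*, `c = 2`; `∏ c_ℓ = 6` (Cremona: `6`) -/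

/-- Row certificate of `487350q1 = [1, -1, 0, -1426854192, 19988598185216]` (stage 1 `TamLocal` at every bad prime + stage 2 `TamX` at the IV*-prime `3`): checks in the
kernel. [cite: Silverman1994, IV.9.4] [cite: Tate1975, §7] [cite: CremonaAlgorithms1997, Table 1 (Cremona label 487350q1)] -/
theorem rowCheckZ_g487350q1 :
    TamZ.rowCheckZ [⟨2, 1, 2, 0, 0, 0, 0, 27, 0, 0, 1⟩, ⟨3, 1, 5, 0, 7, 1, 10, 9, 8, 0, 3⟩, ⟨5, 2, 5, 0, 4, 2, 23, 6, 6, 0, 1⟩, ⟨19, 4, 5, 0, 271, 9, 3294, 9, 9, 0, 2⟩] [⟨3, 1, 3, 7, 1, 10, 9, 1⟩] [⟨5, 9, 4, 2, 23, 6, 0, 0⟩]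
      (⟨1, -1, 0, -1426854192, 19988598185216⟩ : WeierstrassCurve ℤ) = true := by
  decide +kernel

/-- **`∏_ℓ c_ℓ (487350q1) = 6` IN THE KERNEL** for any globally minimal `W / ℚ` with this integral model. [cite: Silverman1994, IV.9.4]
[cite: CremonaAlgorithms1997, Table 1 (Cremona label 487350q1)] -/
theorem tamagawaProduct_g487350q1 {W : WeierstrassCurve ℚ} [W.IsGloballyMinimal]
    (hI : integralModelInt W = (⟨1, -1, 0, -1426854192, 19988598185216⟩ : WeierstrassCurve ℤ)) : W.tamagawaProduct = 6 :=
  (tamagawaProduct_eq_rowValueZ_of_intModel hI rowCheckZ_g487350q1 (by decide +kernel)).trans (by decide +kernel)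

/-- **`c(W / ℚ_[3]) (487350q1) = 3` IN THE KERNEL** (Kodaira type IV* at `3`, residue root witness `1` of the exit quadratic after
`(r, s, t) = (7, 1, 10)`: exact certificate `TamX` kind 3). [cite: Silverman1994, IV.9.4 Step 8] [cite: CremonaAlgorithms1997, Table 1 (Cremona label 487350q1)] -/
theorem localTamagawaNumber_three_g487350q1 {W : WeierstrassCurve ℚ} [W.IsElliptic] [W.IsGloballyMinimal]
    (hI : integralModelInt W = (⟨1, -1, 0, -1426854192, 19988598185216⟩ : WeierstrassCurve ℤ)) :
    (W.baseChange ℚ_[3]).localTamagawaNumber ℤ_[3] = 3 :=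
  localTamagawaNumber_padic_eq_of_intModel_of_tamX hI 3 (F := ⟨3, 1, 3, 7, 1, 10, 9, 1⟩) rfl (by decide +kernel)

/-- **The single-carrier clause of the ♯ₚ record for `487350q1` IN THE KERNEL**: `ord₃ ∏ c_ℓ ≤ ord₃ c₃` (`6 = 3·2`, `3 ∤ 2`).
[cite: Silverman1994, IV.9.4] [cite: CremonaAlgorithms1997, Table 1 (Cremona label 487350q1)] -/
theorem carrier_g487350q1 {W : WeierstrassCurve ℚ} [W.IsElliptic] [W.IsGloballyMinimal]
    (hI : integralModelInt W = (⟨1, -1, 0, -1426854192, 19988598185216⟩ : WeierstrassCurve ℤ)) :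
    padicValNat 3 W.tamagawaProduct ≤ padicValNat 3 ((W.baseChange ℚ_[3]).localTamagawaNumber ℤ_[3]) := by
  rw [tamagawaProduct_g487350q1 hI, localTamagawaNumber_three_g487350q1 hI]
  exact le_of_eq (padicValNat_eq_padicValNat_of_eq_mul (m := 2) Nat.prime_three rfl (by norm_num) (by norm_num))

/-- **RECORD `487350q1` @ `3` with the Tamagawa clause DISCHARGED** — `WildUpperUnitTwistRecords.missingUpperBoundAt_g487350q1_3` (file
`…SharpP23`, ♯ₚ road p610552) with `hcarrier` supplied by `carrier_g487350q1`; every other displayed binder unchanged (named facts,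
schema `hJp`, Cremona's `N = 487350`, `r_an = 0`, «tower not onto», lattice-optimal datum with `3 ∤ c(D)`, `K = ℚ(√-599)`, twist numerics).
Per pair; nothing booked; BSD is not proved by this. [cite: Jetchev2008, Cor. 1.5 (p. 812)] [cite: Silverman1994, IV.9.4]
[cite: Miller2011LMS, Def. 1.1] [cite: CremonaAlgorithms1997, Table 1 (Cremona label 487350q1)] -/
theorem missingUpperBoundAt_g487350q1_3_tam
    (hGZ : ∀ (N : ℕ) [NeZero N] (W : WeierstrassCurve ℚ) (K : Type) [Field K] [NumberField K],
      gross_zagier N W K)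
    (hKo : ∀ (N : ℕ) [NeZero N] (W : WeierstrassCurve ℚ) (K : Type) [Field K] [NumberField K],
      kolyvagin N W K)
    (hGZK : rank_eq_analyticRank_of_analyticRank_le_one) (hmod : hasEntireLFunction_rat)
    (hJp : ∀ (N : ℕ) [NeZero N] (W : WeierstrassCurve ℚ) [W.IsElliptic] [W.IsGloballyMinimal]
      (K : Type) [Field K] [NumberField K],
      IsImaginaryQuadratic K → NumberField.discr K ≠ -3 →
      SatisfiesHeegnerHypothesis N K → SatisfiesHeegnerHypothesis 2 K →
      ∀ (p : ℕ) [Fact p.Prime], p ≠ 2 → W.analyticRank = 0 → Addv W p → 0 ≤ padicValRat p W.j →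
      ¬ W.HasCM → W.HasIrreducibleModPGaloisRep p →
      ¬ (∀ n : ℕ, W.HasSurjectiveModNGaloisRep (p ^ n : ℕ)) →
      (∃ Dt : ModularParametrizationData W N,
        (∀ z ∈ Dt.L.lattice, ∃ w ∈ periodLattice Dt.f, z = (Dt.c : ℂ) * w) ∧ ¬ (p : ℤ) ∣ Dt.c) →
      ∀ {P : (W.baseChange K).toAffine.Point}, IsHeegnerPoint N W K P → ¬ IsOfFinAddOrder P → p ∣ N →
      padicValNat p (Nat.card (AddCommGroup.primaryComponent (W.baseChange K).sha p)) +
          2 * padicValNat p ((W.baseChange ℚ_[p]).localTamagawaNumber ℤ_[p]) ≤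
        2 * padicValNat p (AddSubgroup.zmultiples P).index)
    {W : WeierstrassCurve ℚ} [W.IsElliptic] [W.IsGloballyMinimal] (hWeq : W = (⟨1, (-1), 0, (-1426854192), 19988598185216⟩ : WeierstrassCurve ℚ))
    (hN : W.conductorNorm ℤ = 487350) (hr : W.analyticRank = 0)
    (hns : ¬ (∀ n : ℕ, W.HasSurjectiveModNGaloisRep (3 ^ n : ℕ)))
    (D : ModularParametrizationData W 487350) (hopt : ∀ z ∈ D.L.lattice, ∃ w ∈ periodLattice D.f, z = (D.c : ℂ) * w)
    (hc : ¬ (3 : ℤ) ∣ D.c)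
    (K : Type) [Field K] [NumberField K] (hK : IsImaginaryQuadratic K) (hdK : NumberField.discr K = -599)
    {Wd : WeierstrassCurve ℚ} [Wd.IsElliptic] [Wd.IsGloballyMinimal] (hWdeq : Wd = (⟨1, (-1), 0, (-511956711011067), (-4295908687948109621659)⟩ : WeierstrassCurve ℚ))
    (hrd : Wd.analyticRank = 1) {qd : ℚ} (hqd : shaAn Wd = (qd : ℂ)) (hvd : padicValRat 3 qd ≤ 0) :
    MissingUpperBoundAt W 3 := by
  have hI : integralModelInt W = (⟨1, -1, 0, -1426854192, 19988598185216⟩ : WeierstrassCurve ℤ) := by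
    subst hWeq; exact integralModelInt_eq_of_map_eq _ (map_mk_int 1 (-1) 0 (-1426854192) 19988598185216)
  exact missingUpperBoundAt_g487350q1_3 hGZ hKo hGZK hmod hJp hWeq hN hr hns D hopt hc (carrier_g487350q1 hI) K hK hdK hWdeq hrd hqd hvd

/-! ### `496800cr1` (`N = 496800 = 2^5·3^3·5^2·23`, record file `…SharpP24`): Tate certificates — `2`: III, `c = 2`; `3`: IV*, `c = 3`; `5`: I0*, `c = 1`; `23`: In, `c = 1`; `∏ c_ℓ = 6` (Cremona: `6`) -/

/-- Row certificate of `496800cr1 = [0, 0, 0, -47925, 3969000]` (stage 1 `TamLocal` at every bad prime + stage 2 `TamX` at the IV*-prime `3`): checks in the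
kernel. [cite: Silverman1994, IV.9.4] [cite: Tate1975, §7] [cite: CremonaAlgorithms1997, Table 1 (Cremona label 496800cr1)] -/
theorem rowCheckZ_g496800cr1 :
    TamZ.rowCheckZ [⟨2, 1, 4, 0, 1, 0, 0, 6, 3, 2, 2⟩, ⟨3, 1, 5, 0, 0, 0, 0, 9, 8, 0, 3⟩, ⟨5, 2, 5, 0, 0, 0, 0, 6, 6, 0, 1⟩, ⟨23, 4, 3, 0, 0, 0, 0, 3, 0, 0, 1⟩] [⟨3, 1, 3, 0, 0, 0, 9, 1⟩] [⟨5, 9, 0, 0, 0, 6, 0, 0⟩]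
      (⟨0, 0, 0, -47925, 3969000⟩ : WeierstrassCurve ℤ) = true := by
  decide +kernel

/-- **`∏_ℓ c_ℓ (496800cr1) = 6` IN THE KERNEL** for any globally minimal `W / ℚ` with this integral model. [cite: Silverman1994, IV.9.4]
[cite: CremonaAlgorithms1997, Table 1 (Cremona label 496800cr1)] -/
theorem tamagawaProduct_g496800cr1 {W : WeierstrassCurve ℚ} [W.IsGloballyMinimal]
    (hI : integralModelInt W = (⟨0, 0, 0, -47925, 3969000⟩ : WeierstrassCurve ℤ)) : W.tamagawaProduct = 6 :=
  (tamagawaProduct_eq_rowValueZ_of_intModel hI rowCheckZ_g496800cr1 (by decide +kernel)).trans (by decide +kernel)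

/-- **`c(W / ℚ_[3]) (496800cr1) = 3` IN THE KERNEL** (Kodaira type IV* at `3`, residue root witness `1` of the exit quadratic after
`(r, s, t) = (0, 0, 0)`: exact certificate `TamX` kind 3). [cite: Silverman1994, IV.9.4 Step 8] [cite: CremonaAlgorithms1997, Table 1 (Cremona label 496800cr1)] -/
theorem localTamagawaNumber_three_g496800cr1 {W : WeierstrassCurve ℚ} [W.IsElliptic] [W.IsGloballyMinimal]
    (hI : integralModelInt W = (⟨0, 0, 0, -47925, 3969000⟩ : WeierstrassCurve ℤ)) :
    (W.baseChange ℚ_[3]).localTamagawaNumber ℤ_[3] = 3 :=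
  localTamagawaNumber_padic_eq_of_intModel_of_tamX hI 3 (F := ⟨3, 1, 3, 0, 0, 0, 9, 1⟩) rfl (by decide +kernel)

/-- **The single-carrier clause of the ♯ₚ record for `496800cr1` IN THE KERNEL**: `ord₃ ∏ c_ℓ ≤ ord₃ c₃` (`6 = 3·2`, `3 ∤ 2`).
[cite: Silverman1994, IV.9.4] [cite: CremonaAlgorithms1997, Table 1 (Cremona label 496800cr1)] -/
theorem carrier_g496800cr1 {W : WeierstrassCurve ℚ} [W.IsElliptic] [W.IsGloballyMinimal]
    (hI : integralModelInt W = (⟨0, 0, 0, -47925, 3969000⟩ : WeierstrassCurve ℤ)) :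
    padicValNat 3 W.tamagawaProduct ≤ padicValNat 3 ((W.baseChange ℚ_[3]).localTamagawaNumber ℤ_[3]) := by
  rw [tamagawaProduct_g496800cr1 hI, localTamagawaNumber_three_g496800cr1 hI]
  exact le_of_eq (padicValNat_eq_padicValNat_of_eq_mul (m := 2) Nat.prime_three rfl (by norm_num) (by norm_num))

/-- **RECORD `496800cr1` @ `3` with the Tamagawa clause DISCHARGED** — `WildUpperUnitTwistRecords.missingUpperBoundAt_g496800cr1_3` (file
`…SharpP24`, ♯ₚ road p610552) with `hcarrier` supplied by `carrier_g496800cr1`; every other displayed binder unchanged (named facts,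
schema `hJp`, Cremona's `N = 496800`, `r_an = 0`, «tower not onto», lattice-optimal datum with `3 ∤ c(D)`, `K = ℚ(√-191)`, twist numerics).
Per pair; nothing booked; BSD is not proved by this. [cite: Jetchev2008, Cor. 1.5 (p. 812)] [cite: Silverman1994, IV.9.4]
[cite: Miller2011LMS, Def. 1.1] [cite: CremonaAlgorithms1997, Table 1 (Cremona label 496800cr1)] -/
theorem missingUpperBoundAt_g496800cr1_3_tam
    (hGZ : ∀ (N : ℕ) [NeZero N] (W : WeierstrassCurve ℚ) (K : Type) [Field K] [NumberField K],
      gross_zagier N W K)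
    (hKo : ∀ (N : ℕ) [NeZero N] (W : WeierstrassCurve ℚ) (K : Type) [Field K] [NumberField K],
      kolyvagin N W K)
    (hGZK : rank_eq_analyticRank_of_analyticRank_le_one) (hmod : hasEntireLFunction_rat)
    (hJp : ∀ (N : ℕ) [NeZero N] (W : WeierstrassCurve ℚ) [W.IsElliptic] [W.IsGloballyMinimal]
      (K : Type) [Field K] [NumberField K],
      IsImaginaryQuadratic K → NumberField.discr K ≠ -3 →
      SatisfiesHeegnerHypothesis N K → SatisfiesHeegnerHypothesis 2 K →
      ∀ (p : ℕ) [Fact p.Prime], p ≠ 2 → W.analyticRank = 0 → Addv W p → 0 ≤ padicValRat p W.j →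
      ¬ W.HasCM → W.HasIrreducibleModPGaloisRep p →
      ¬ (∀ n : ℕ, W.HasSurjectiveModNGaloisRep (p ^ n : ℕ)) →
      (∃ Dt : ModularParametrizationData W N,
        (∀ z ∈ Dt.L.lattice, ∃ w ∈ periodLattice Dt.f, z = (Dt.c : ℂ) * w) ∧ ¬ (p : ℤ) ∣ Dt.c) →
      ∀ {P : (W.baseChange K).toAffine.Point}, IsHeegnerPoint N W K P → ¬ IsOfFinAddOrder P → p ∣ N →
      padicValNat p (Nat.card (AddCommGroup.primaryComponent (W.baseChange K).sha p)) +
          2 * padicValNat p ((W.baseChange ℚ_[p]).localTamagawaNumber ℤ_[p]) ≤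
        2 * padicValNat p (AddSubgroup.zmultiples P).index)
    {W : WeierstrassCurve ℚ} [W.IsElliptic] [W.IsGloballyMinimal] (hWeq : W = (⟨0, 0, 0, (-47925), 3969000⟩ : WeierstrassCurve ℚ))
    (hN : W.conductorNorm ℤ = 496800) (hr : W.analyticRank = 0)
    (hns : ¬ (∀ n : ℕ, W.HasSurjectiveModNGaloisRep (3 ^ n : ℕ)))
    (D : ModularParametrizationData W 496800) (hopt : ∀ z ∈ D.L.lattice, ∃ w ∈ periodLattice D.f, z = (D.c : ℂ) * w)
    (hc : ¬ (3 : ℤ) ∣ D.c)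
    (K : Type) [Field K] [NumberField K] (hK : IsImaginaryQuadratic K) (hdK : NumberField.discr K = -191)
    {Wd : WeierstrassCurve ℚ} [Wd.IsElliptic] [Wd.IsGloballyMinimal] (hWdeq : Wd = (⟨0, 0, 0, (-1748351925), (-27655479999000)⟩ : WeierstrassCurve ℚ))
    (hrd : Wd.analyticRank = 1) {qd : ℚ} (hqd : shaAn Wd = (qd : ℂ)) (hvd : padicValRat 3 qd ≤ 0) :
    MissingUpperBoundAt W 3 := by
  have hI : integralModelInt W = (⟨0, 0, 0, -47925, 3969000⟩ : WeierstrassCurve ℤ) := by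
    subst hWeq; exact integralModelInt_eq_of_map_eq _ (map_mk_int 0 0 0 (-47925) 3969000)
  exact missingUpperBoundAt_g496800cr1_3 hGZ hKo hGZK hmod hJp hWeq hN hr hns D hopt hc (carrier_g496800cr1 hI) K hK hdK hWdeq hrd hqd hvd

/-! ### `388800ha1` (`N = 388800 = 2^6·3^5·5^2`, record file `…SharpP25`): Tate certificates — `2`: II, `c = 1`; `3`: IV*, `c = 3`; `5`: II, `c = 1`; `∏ c_ℓ = 3` (Cremona: `3`) -/

/-- Row certificate of `388800ha1 = [0, 0, 0, -4860, -130410]` (stage 1 `TamLocal` at every bad prime + stage 2 `TamX` at the IV*-prime `3`): checks in the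
kernel. [cite: Silverman1994, IV.9.4] [cite: Tate1975, §7] [cite: CremonaAlgorithms1997, Table 1 (Cremona label 388800ha1)] -/
theorem rowCheckZ_g388800ha1 :
    TamZ.rowCheckZ [⟨2, 1, 4, 0, 0, 0, 0, 6, 2, 1, 1⟩, ⟨3, 1, 5, 0, 0, 0, 0, 11, 8, 0, 3⟩, ⟨5, 2, 4, 0, 0, 0, 0, 2, 2, 1, 1⟩] [⟨3, 1, 3, 0, 0, 0, 11, 1⟩] []
      (⟨0, 0, 0, -4860, -130410⟩ : WeierstrassCurve ℤ) = true := by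
  decide +kernel

/-- **`∏_ℓ c_ℓ (388800ha1) = 3` IN THE KERNEL** for any globally minimal `W / ℚ` with this integral model. [cite: Silverman1994, IV.9.4]
[cite: CremonaAlgorithms1997, Table 1 (Cremona label 388800ha1)] -/
theorem tamagawaProduct_g388800ha1 {W : WeierstrassCurve ℚ} [W.IsGloballyMinimal]
    (hI : integralModelInt W = (⟨0, 0, 0, -4860, -130410⟩ : WeierstrassCurve ℤ)) : W.tamagawaProduct = 3 :=
  (tamagawaProduct_eq_rowValueZ_of_intModel hI rowCheckZ_g388800ha1 (by decide +kernel)).trans (by decide +kernel)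

/-- **`c(W / ℚ_[3]) (388800ha1) = 3` IN THE KERNEL** (Kodaira type IV* at `3`, residue root witness `1` of the exit quadratic after
`(r, s, t) = (0, 0, 0)`: exact certificate `TamX` kind 3). [cite: Silverman1994, IV.9.4 Step 8] [cite: CremonaAlgorithms1997, Table 1 (Cremona label 388800ha1)] -/
theorem localTamagawaNumber_three_g388800ha1 {W : WeierstrassCurve ℚ} [W.IsElliptic] [W.IsGloballyMinimal]
    (hI : integralModelInt W = (⟨0, 0, 0, -4860, -130410⟩ : WeierstrassCurve ℤ)) :
    (W.baseChange ℚ_[3]).localTamagawaNumber ℤ_[3] = 3 :=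
  localTamagawaNumber_padic_eq_of_intModel_of_tamX hI 3 (F := ⟨3, 1, 3, 0, 0, 0, 11, 1⟩) rfl (by decide +kernel)

/-- **The single-carrier clause of the ♯ₚ record for `388800ha1` IN THE KERNEL**: `ord₃ ∏ c_ℓ ≤ ord₃ c₃` (`3 = 3·1`, `3 ∤ 1`).
[cite: Silverman1994, IV.9.4] [cite: CremonaAlgorithms1997, Table 1 (Cremona label 388800ha1)] -/
theorem carrier_g388800ha1 {W : WeierstrassCurve ℚ} [W.IsElliptic] [W.IsGloballyMinimal]
    (hI : integralModelInt W = (⟨0, 0, 0, -4860, -130410⟩ : WeierstrassCurve ℤ)) :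
    padicValNat 3 W.tamagawaProduct ≤ padicValNat 3 ((W.baseChange ℚ_[3]).localTamagawaNumber ℤ_[3]) := by
  rw [tamagawaProduct_g388800ha1 hI, localTamagawaNumber_three_g388800ha1 hI]

/-- **RECORD `388800ha1` @ `3` with the Tamagawa clause DISCHARGED** — `WildUpperUnitTwistRecords.missingUpperBoundAt_g388800ha1_3` (file
`…SharpP25`, ♯ₚ road p610552) with `hcarrier` supplied by `carrier_g388800ha1`; every other displayed binder unchanged (named facts,
schema `hJp`, Cremona's `N = 388800`, `r_an = 0`, «tower not onto», lattice-optimal datum with `3 ∤ c(D)`, `K = ℚ(√-71)`, twist numerics).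
Per pair; nothing booked; BSD is not proved by this. [cite: Jetchev2008, Cor. 1.5 (p. 812)] [cite: Silverman1994, IV.9.4]
[cite: Miller2011LMS, Def. 1.1] [cite: CremonaAlgorithms1997, Table 1 (Cremona label 388800ha1)] -/
theorem missingUpperBoundAt_g388800ha1_3_tam
    (hGZ : ∀ (N : ℕ) [NeZero N] (W : WeierstrassCurve ℚ) (K : Type) [Field K] [NumberField K],
      gross_zagier N W K)
    (hKo : ∀ (N : ℕ) [NeZero N] (W : WeierstrassCurve ℚ) (K : Type) [Field K] [NumberField K],
      kolyvagin N W K)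
    (hGZK : rank_eq_analyticRank_of_analyticRank_le_one) (hmod : hasEntireLFunction_rat)
    (hJp : ∀ (N : ℕ) [NeZero N] (W : WeierstrassCurve ℚ) [W.IsElliptic] [W.IsGloballyMinimal]
      (K : Type) [Field K] [NumberField K],
      IsImaginaryQuadratic K → NumberField.discr K ≠ -3 →
      SatisfiesHeegnerHypothesis N K → SatisfiesHeegnerHypothesis 2 K →
      ∀ (p : ℕ) [Fact p.Prime], p ≠ 2 → W.analyticRank = 0 → Addv W p → 0 ≤ padicValRat p W.j →
      ¬ W.HasCM → W.HasIrreducibleModPGaloisRep p →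
      ¬ (∀ n : ℕ, W.HasSurjectiveModNGaloisRep (p ^ n : ℕ)) →
      (∃ Dt : ModularParametrizationData W N,
        (∀ z ∈ Dt.L.lattice, ∃ w ∈ periodLattice Dt.f, z = (Dt.c : ℂ) * w) ∧ ¬ (p : ℤ) ∣ Dt.c) →
      ∀ {P : (W.baseChange K).toAffine.Point}, IsHeegnerPoint N W K P → ¬ IsOfFinAddOrder P → p ∣ N →
      padicValNat p (Nat.card (AddCommGroup.primaryComponent (W.baseChange K).sha p)) +
          2 * padicValNat p ((W.baseChange ℚ_[p]).localTamagawaNumber ℤ_[p]) ≤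
        2 * padicValNat p (AddSubgroup.zmultiples P).index)
    {W : WeierstrassCurve ℚ} [W.IsElliptic] [W.IsGloballyMinimal] (hWeq : W = (⟨0, 0, 0, (-4860), (-130410)⟩ : WeierstrassCurve ℚ))
    (hN : W.conductorNorm ℤ = 388800) (hr : W.analyticRank = 0)
    (hns : ¬ (∀ n : ℕ, W.HasSurjectiveModNGaloisRep (3 ^ n : ℕ)))
    (D : ModularParametrizationData W 388800) (hopt : ∀ z ∈ D.L.lattice, ∃ w ∈ periodLattice D.f, z = (D.c : ℂ) * w)
    (hc : ¬ (3 : ℤ) ∣ D.c)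
    (K : Type) [Field K] [NumberField K] (hK : IsImaginaryQuadratic K) (hdK : NumberField.discr K = -71)
    {Wd : WeierstrassCurve ℚ} [Wd.IsElliptic] [Wd.IsGloballyMinimal] (hWdeq : Wd = (⟨0, 0, 0, (-24499260), 46675173510⟩ : WeierstrassCurve ℚ))
    (hrd : Wd.analyticRank = 1) {qd : ℚ} (hqd : shaAn Wd = (qd : ℂ)) (hvd : padicValRat 3 qd ≤ 0) :
    MissingUpperBoundAt W 3 := by
  have hI : integralModelInt W = (⟨0, 0, 0, -4860, -130410⟩ : WeierstrassCurve ℤ) := by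
    subst hWeq; exact integralModelInt_eq_of_map_eq _ (map_mk_int 0 0 0 (-4860) (-130410))
  exact missingUpperBoundAt_g388800ha1_3 hGZ hKo hGZK hmod hJp hWeq hN hr hns D hopt hc (carrier_g388800ha1 hI) K hK hdK hWdeq hrd hqd hvd

/-! ### `388800ij1` (`N = 388800 = 2^6·3^5·5^2`, record file `…SharpP25`): Tate certificates — `2`: II, `c = 1`; `3`: IV*, `c = 3`; `5`: IV*, `c = 1`; `∏ c_ℓ = 3` (Cremona: `3`) -/

/-- Row certificate of `388800ij1 = [0, 0, 0, -121500, 16301250]` (stage 1 `TamLocal` at every bad prime + stage 2 `TamX` at the IV*-prime `3`): checks in the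
kernel. [cite: Silverman1994, IV.9.4] [cite: Tate1975, §7] [cite: CremonaAlgorithms1997, Table 1 (Cremona label 388800ij1)] -/
theorem rowCheckZ_g388800ij1 :
    TamZ.rowCheckZ [⟨2, 1, 4, 0, 0, 0, 0, 6, 2, 1, 1⟩, ⟨3, 1, 5, 0, 0, 0, 0, 11, 8, 0, 3⟩, ⟨5, 2, 5, 0, 0, 0, 0, 8, 8, 0, 1⟩] [⟨3, 1, 3, 0, 0, 0, 11, 1⟩, ⟨5, 2, 4, 0, 0, 0, 8, 0⟩] []
      (⟨0, 0, 0, -121500, 16301250⟩ : WeierstrassCurve ℤ) = true := by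
  decide +kernel

/-- **`∏_ℓ c_ℓ (388800ij1) = 3` IN THE KERNEL** for any globally minimal `W / ℚ` with this integral model. [cite: Silverman1994, IV.9.4]
[cite: CremonaAlgorithms1997, Table 1 (Cremona label 388800ij1)] -/
theorem tamagawaProduct_g388800ij1 {W : WeierstrassCurve ℚ} [W.IsGloballyMinimal]
    (hI : integralModelInt W = (⟨0, 0, 0, -121500, 16301250⟩ : WeierstrassCurve ℤ)) : W.tamagawaProduct = 3 :=
  (tamagawaProduct_eq_rowValueZ_of_intModel hI rowCheckZ_g388800ij1 (by decide +kernel)).trans (by decide +kernel)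

/-- **`c(W / ℚ_[3]) (388800ij1) = 3` IN THE KERNEL** (Kodaira type IV* at `3`, residue root witness `1` of the exit quadratic after
`(r, s, t) = (0, 0, 0)`: exact certificate `TamX` kind 3). [cite: Silverman1994, IV.9.4 Step 8] [cite: CremonaAlgorithms1997, Table 1 (Cremona label 388800ij1)] -/
theorem localTamagawaNumber_three_g388800ij1 {W : WeierstrassCurve ℚ} [W.IsElliptic] [W.IsGloballyMinimal]
    (hI : integralModelInt W = (⟨0, 0, 0, -121500, 16301250⟩ : WeierstrassCurve ℤ)) :
    (W.baseChange ℚ_[3]).localTamagawaNumber ℤ_[3] = 3 :=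
  localTamagawaNumber_padic_eq_of_intModel_of_tamX hI 3 (F := ⟨3, 1, 3, 0, 0, 0, 11, 1⟩) rfl (by decide +kernel)

/-- **The single-carrier clause of the ♯ₚ record for `388800ij1` IN THE KERNEL**: `ord₃ ∏ c_ℓ ≤ ord₃ c₃` (`3 = 3·1`, `3 ∤ 1`).
[cite: Silverman1994, IV.9.4] [cite: CremonaAlgorithms1997, Table 1 (Cremona label 388800ij1)] -/
theorem carrier_g388800ij1 {W : WeierstrassCurve ℚ} [W.IsElliptic] [W.IsGloballyMinimal]
    (hI : integralModelInt W = (⟨0, 0, 0, -121500, 16301250⟩ : WeierstrassCurve ℤ)) :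
    padicValNat 3 W.tamagawaProduct ≤ padicValNat 3 ((W.baseChange ℚ_[3]).localTamagawaNumber ℤ_[3]) := by
  rw [tamagawaProduct_g388800ij1 hI, localTamagawaNumber_three_g388800ij1 hI]

/-- **RECORD `388800ij1` @ `3` with the Tamagawa clause DISCHARGED** — `WildUpperUnitTwistRecords.missingUpperBoundAt_g388800ij1_3` (file
`…SharpP25`, ♯ₚ road p610552) with `hcarrier` supplied by `carrier_g388800ij1`; every other displayed binder unchanged (named facts,
schema `hJp`, Cremona's `N = 388800`, `r_an = 0`, «tower not onto», lattice-optimal datum with `3 ∤ c(D)`, `K = ℚ(√-119)`, twist numerics).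
Per pair; nothing booked; BSD is not proved by this. [cite: Jetchev2008, Cor. 1.5 (p. 812)] [cite: Silverman1994, IV.9.4]
[cite: Miller2011LMS, Def. 1.1] [cite: CremonaAlgorithms1997, Table 1 (Cremona label 388800ij1)] -/
theorem missingUpperBoundAt_g388800ij1_3_tam
    (hGZ : ∀ (N : ℕ) [NeZero N] (W : WeierstrassCurve ℚ) (K : Type) [Field K] [NumberField K],
      gross_zagier N W K)
    (hKo : ∀ (N : ℕ) [NeZero N] (W : WeierstrassCurve ℚ) (K : Type) [Field K] [NumberField K],
      kolyvagin N W K)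
    (hGZK : rank_eq_analyticRank_of_analyticRank_le_one) (hmod : hasEntireLFunction_rat)
    (hJp : ∀ (N : ℕ) [NeZero N] (W : WeierstrassCurve ℚ) [W.IsElliptic] [W.IsGloballyMinimal]
      (K : Type) [Field K] [NumberField K],
      IsImaginaryQuadratic K → NumberField.discr K ≠ -3 →
      SatisfiesHeegnerHypothesis N K → SatisfiesHeegnerHypothesis 2 K →
      ∀ (p : ℕ) [Fact p.Prime], p ≠ 2 → W.analyticRank = 0 → Addv W p → 0 ≤ padicValRat p W.j →
      ¬ W.HasCM → W.HasIrreducibleModPGaloisRep p →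
      ¬ (∀ n : ℕ, W.HasSurjectiveModNGaloisRep (p ^ n : ℕ)) →
      (∃ Dt : ModularParametrizationData W N,
        (∀ z ∈ Dt.L.lattice, ∃ w ∈ periodLattice Dt.f, z = (Dt.c : ℂ) * w) ∧ ¬ (p : ℤ) ∣ Dt.c) →
      ∀ {P : (W.baseChange K).toAffine.Point}, IsHeegnerPoint N W K P → ¬ IsOfFinAddOrder P → p ∣ N →
      padicValNat p (Nat.card (AddCommGroup.primaryComponent (W.baseChange K).sha p)) +
          2 * padicValNat p ((W.baseChange ℚ_[p]).localTamagawaNumber ℤ_[p]) ≤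
        2 * padicValNat p (AddSubgroup.zmultiples P).index)
    {W : WeierstrassCurve ℚ} [W.IsElliptic] [W.IsGloballyMinimal] (hWeq : W = (⟨0, 0, 0, (-121500), 16301250⟩ : WeierstrassCurve ℚ))
    (hN : W.conductorNorm ℤ = 388800) (hr : W.analyticRank = 0)
    (hns : ¬ (∀ n : ℕ, W.HasSurjectiveModNGaloisRep (3 ^ n : ℕ)))
    (D : ModularParametrizationData W 388800) (hopt : ∀ z ∈ D.L.lattice, ∃ w ∈ periodLattice D.f, z = (D.c : ℂ) * w)
    (hc : ¬ (3 : ℤ) ∣ D.c)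
    (K : Type) [Field K] [NumberField K] (hK : IsImaginaryQuadratic K) (hdK : NumberField.discr K = -119)
    {Wd : WeierstrassCurve ℚ} [Wd.IsElliptic] [Wd.IsGloballyMinimal] (hWdeq : Wd = (⟨0, 0, 0, (-1720561500), (-27470198148750)⟩ : WeierstrassCurve ℚ))
    (hrd : Wd.analyticRank = 1) {qd : ℚ} (hqd : shaAn Wd = (qd : ℂ)) (hvd : padicValRat 3 qd ≤ 0) :
    MissingUpperBoundAt W 3 := by
  have hI : integralModelInt W = (⟨0, 0, 0, -121500, 16301250⟩ : WeierstrassCurve ℤ) := by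
    subst hWeq; exact integralModelInt_eq_of_map_eq _ (map_mk_int 0 0 0 (-121500) 16301250)
  exact missingUpperBoundAt_g388800ij1_3 hGZ hKo hGZK hmod hJp hWeq hN hr hns D hopt hc (carrier_g388800ij1 hI) K hK hdK hWdeq hrd hqd hvd

/-! ### `81675bq1` (`N = 81675 = 3^3·5^2·11^2`, record file `…SharpP26`): Tate certificates — `3`: IV*, `c = 3`; `5`: In*, `c = 4`; `11`: III*, `c = 2`; `∏ c_ℓ = 24` (Cremona: `24`) -/

/-- Row certificate of `81675bq1 = [0, 0, 1, -3593700, -2581848844]` (stage 1 `TamLocal` at every bad prime + stage 2 `TamX` at the IV*-prime `3`): checks in the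
kernel. [cite: Silverman1994, IV.9.4] [cite: Tate1975, §7] [cite: CremonaAlgorithms1997, Table 1 (Cremona label 81675bq1)] -/
theorem rowCheckZ_g81675bq1 :
    TamZ.rowCheckZ [⟨3, 1, 5, 0, 3, 0, 4, 9, 8, 0, 3⟩, ⟨5, 2, 5, 0, 20, 0, 62, 9, 71, 1, 4⟩, ⟨11, 3, 5, 0, 0, 0, 665, 9, 9, 0, 2⟩] [⟨3, 1, 3, 3, 0, 4, 9, 0⟩] [⟨5, 5, 20, 0, 62, 9, 1, 1⟩]
      (⟨0, 0, 1, -3593700, -2581848844⟩ : WeierstrassCurve ℤ) = true := by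
  decide +kernel

/-- **`∏_ℓ c_ℓ (81675bq1) = 24` IN THE KERNEL** for any globally minimal `W / ℚ` with this integral model. [cite: Silverman1994, IV.9.4]
[cite: CremonaAlgorithms1997, Table 1 (Cremona label 81675bq1)] -/
theorem tamagawaProduct_g81675bq1 {W : WeierstrassCurve ℚ} [W.IsGloballyMinimal]
    (hI : integralModelInt W = (⟨0, 0, 1, -3593700, -2581848844⟩ : WeierstrassCurve ℤ)) : W.tamagawaProduct = 24 :=
  (tamagawaProduct_eq_rowValueZ_of_intModel hI rowCheckZ_g81675bq1 (by decide +kernel)).trans (by decide +kernel)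

/-- **`c(W / ℚ_[3]) (81675bq1) = 3` IN THE KERNEL** (Kodaira type IV* at `3`, residue root witness `0` of the exit quadratic after
`(r, s, t) = (3, 0, 4)`: exact certificate `TamX` kind 3). [cite: Silverman1994, IV.9.4 Step 8] [cite: CremonaAlgorithms1997, Table 1 (Cremona label 81675bq1)] -/
theorem localTamagawaNumber_three_g81675bq1 {W : WeierstrassCurve ℚ} [W.IsElliptic] [W.IsGloballyMinimal]
    (hI : integralModelInt W = (⟨0, 0, 1, -3593700, -2581848844⟩ : WeierstrassCurve ℤ)) :
    (W.baseChange ℚ_[3]).localTamagawaNumber ℤ_[3] = 3 :=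
  localTamagawaNumber_padic_eq_of_intModel_of_tamX hI 3 (F := ⟨3, 1, 3, 3, 0, 4, 9, 0⟩) rfl (by decide +kernel)

/-- **The single-carrier clause of the ♯ₚ record for `81675bq1` IN THE KERNEL**: `ord₃ ∏ c_ℓ ≤ ord₃ c₃` (`24 = 3·8`, `3 ∤ 8`).
[cite: Silverman1994, IV.9.4] [cite: CremonaAlgorithms1997, Table 1 (Cremona label 81675bq1)] -/
theorem carrier_g81675bq1 {W : WeierstrassCurve ℚ} [W.IsElliptic] [W.IsGloballyMinimal]
    (hI : integralModelInt W = (⟨0, 0, 1, -3593700, -2581848844⟩ : WeierstrassCurve ℤ)) :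
    padicValNat 3 W.tamagawaProduct ≤ padicValNat 3 ((W.baseChange ℚ_[3]).localTamagawaNumber ℤ_[3]) := by
  rw [tamagawaProduct_g81675bq1 hI, localTamagawaNumber_three_g81675bq1 hI]
  exact le_of_eq (padicValNat_eq_padicValNat_of_eq_mul (m := 8) Nat.prime_three rfl (by norm_num) (by norm_num))

/-- **RECORD `81675bq1` @ `3` with the Tamagawa clause DISCHARGED** — `WildUpperUnitTwistRecords.missingUpperBoundAt_g81675bq1_3` (file
`…SharpP26`, ♯ₚ road p610552) with `hcarrier` supplied by `carrier_g81675bq1`; every other displayed binder unchanged (named facts,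
schema `hJp`, Cremona's `N = 81675`, `r_an = 0`, «tower not onto», lattice-optimal datum with `3 ∤ c(D)`, `K = ℚ(√-239)`, twist numerics).
Per pair; nothing booked; BSD is not proved by this. [cite: Jetchev2008, Cor. 1.5 (p. 812)] [cite: Silverman1994, IV.9.4]
[cite: Miller2011LMS, Def. 1.1] [cite: CremonaAlgorithms1997, Table 1 (Cremona label 81675bq1)] -/
theorem missingUpperBoundAt_g81675bq1_3_tam
    (hGZ : ∀ (N : ℕ) [NeZero N] (W : WeierstrassCurve ℚ) (K : Type) [Field K] [NumberField K],
      gross_zagier N W K)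
    (hKo : ∀ (N : ℕ) [NeZero N] (W : WeierstrassCurve ℚ) (K : Type) [Field K] [NumberField K],
      kolyvagin N W K)
    (hGZK : rank_eq_analyticRank_of_analyticRank_le_one) (hmod : hasEntireLFunction_rat)
    (hJp : ∀ (N : ℕ) [NeZero N] (W : WeierstrassCurve ℚ) [W.IsElliptic] [W.IsGloballyMinimal]
      (K : Type) [Field K] [NumberField K],
      IsImaginaryQuadratic K → NumberField.discr K ≠ -3 →
      SatisfiesHeegnerHypothesis N K → SatisfiesHeegnerHypothesis 2 K →
      ∀ (p : ℕ) [Fact p.Prime], p ≠ 2 → W.analyticRank = 0 → Addv W p → 0 ≤ padicValRat p W.j →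
      ¬ W.HasCM → W.HasIrreducibleModPGaloisRep p →
      ¬ (∀ n : ℕ, W.HasSurjectiveModNGaloisRep (p ^ n : ℕ)) →
      (∃ Dt : ModularParametrizationData W N,
        (∀ z ∈ Dt.L.lattice, ∃ w ∈ periodLattice Dt.f, z = (Dt.c : ℂ) * w) ∧ ¬ (p : ℤ) ∣ Dt.c) →
      ∀ {P : (W.baseChange K).toAffine.Point}, IsHeegnerPoint N W K P → ¬ IsOfFinAddOrder P → p ∣ N →
      padicValNat p (Nat.card (AddCommGroup.primaryComponent (W.baseChange K).sha p)) +
          2 * padicValNat p ((W.baseChange ℚ_[p]).localTamagawaNumber ℤ_[p]) ≤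
        2 * padicValNat p (AddSubgroup.zmultiples P).index)
    {W : WeierstrassCurve ℚ} [W.IsElliptic] [W.IsGloballyMinimal] (hWeq : W = (⟨0, 0, 1, (-3593700), (-2581848844)⟩ : WeierstrassCurve ℚ))
    (hN : W.conductorNorm ℤ = 81675) (hr : W.analyticRank = 0)
    (hns : ¬ (∀ n : ℕ, W.HasSurjectiveModNGaloisRep (3 ^ n : ℕ)))
    (D : ModularParametrizationData W 81675) (hopt : ∀ z ∈ D.L.lattice, ∃ w ∈ periodLattice D.f, z = (D.c : ℂ) * w)
    (hc : ¬ (3 : ℤ) ∣ D.c)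
    (K : Type) [Field K] [NumberField K] (hK : IsImaginaryQuadratic K) (hdK : NumberField.discr K = -239)
    {Wd : WeierstrassCurve ℚ} [Wd.IsElliptic] [Wd.IsGloballyMinimal] (hWdeq : Wd = (⟨0, 0, 1, (-205275737700), 35247191285118656⟩ : WeierstrassCurve ℚ))
    (hrd : Wd.analyticRank = 1) {qd : ℚ} (hqd : shaAn Wd = (qd : ℂ)) (hvd : padicValRat 3 qd ≤ 0) :
    MissingUpperBoundAt W 3 := by
  have hI : integralModelInt W = (⟨0, 0, 1, -3593700, -2581848844⟩ : WeierstrassCurve ℤ) := by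
    subst hWeq; exact integralModelInt_eq_of_map_eq _ (map_mk_int 0 0 1 (-3593700) (-2581848844))
  exact missingUpperBoundAt_g81675bq1_3 hGZ hKo hGZK hmod hJp hWeq hN hr hns D hopt hc (carrier_g81675bq1 hI) K hK hdK hWdeq hrd hqd hvd

end Summit.BirchSwinnertonDyer.BirchSwinnertonDyer.Theorems.WildUpperUnitTwistRecords

end
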